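import Summits.BirchSwinnertonDyer.BirchSwinnertonDyer.Theorems.InertBadSignedBranchesCccOneLawOnTypeIstarZeroDepletedValueGlue
import Summits.BirchSwinnertonDyer.Rank1Residual.Additive.KatoDescentKatoRigidDepletedValues
import HarnessLib

set_option linter.dupNamespace false

/-!
# Kato's value law (C5) made PERIOD-FREE at every level: `τ(χ̄) · Σ_b χ(b) ι(σ_b x) = ± κ · P_χ(1) · (Σ_a χ̄(a)[a/m]^±_f) · R^∓_χ̄`
# — crux `CccOneLawOnTypeIstarZero` (stmt-BirchSwinnertonDyer-19223, route `InertBadSignedBranches`),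
# refill hand `leafhand-bsd-inertbadsignedbran-10` g0, file 3

Def-free helper file (theorems only; `--supports stmt-BirchSwinnertonDyer-19223`); the per-level use of file 1
(`…DepletedValueGlue`, docket P1) on the value law (C5) of `Kato2004.ZetaBody` — the left-hand currency of every `hC`-type
bookkeeping stub of 2c-T1 (census ev #47 «Stuck goal»: `(C5)+Birch(f_W)`).  Kato's (C5) (Thm. 9.7 ∘ Thm. 6.6 (1)) reads, at level
`m = p^k·∏ℓ` and for EVERY Dirichlet character `χ` mod `m` and EVERY depleted continuation `Lχ` of `L_{(mpA)}(f, χ, s)`: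
`Σ_b χ(b) ι_m(σ_b x_{k,r}) = κ · Lχ(1)/Ω⁺_f · R⁻_χ̄(c,d,a,A,d′)` (`χ` even), `= −κ · Lχ(1)/(iΩ⁻_f) · R⁺_χ̄` (`χ` odd), with the
TRANSCENDENTAL factor `Lχ(1)/Ω^±_f`.  For a RATIONAL newform `f` (`IsNewform0 f`, `coeffField f = ⊥`) and a PRIMITIVE `χ` this factor
is algebraic: file 1's depleted Birch formula gives `Lχ(1)/Ω⁺_f = P_χ(1) · (Σ_a χ̄(a)[a/m]⁺_f)/τ(χ̄)`.  Hence, with NO continuation and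
NO period left in the statement (a depleted continuation EXISTS — tree `isDepletedTwistedL_eulerFactors_mul` on Shimura's continuation
`exists_differentiable_eq_twistedLSeries_holds` — and (C5) holds for it):
* §1 ★ `gaussSum_inv_mul_charSum_eq_of_even`: `τ(χ̄) · Σ_b χ(b) ι(σ_b x_{k,r}) = κ · P_χ(1) · (Σ_a χ̄(a)[a/m]⁺_f) · R⁻_χ̄(c,d,a,A,d′)`,
  `P_χ(1) = ∏_{ℓ ∣ m·pA, ℓ ∤ m} (1 − χ(ℓ)a_ℓ ℓ⁻¹ + 𝟙_N(ℓ)χ(ℓ)² ℓ·(ℓ⁻¹)²)` (tree bytes), and the solved form `charSum_eq_of_even`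
  (`τ(χ̄) ≠ 0`);
* §2 ★ `gaussSum_inv_mul_charSum_eq_of_odd`: `τ(χ̄) · Σ_b χ(b) ι(σ_b x_{k,r}) = −κ · P_χ(1) · (Σ_a χ̄(a)[a/m]⁻_f) · R⁺_χ̄`, and
  `charSum_eq_of_odd`.
Both sides are now values of EXPLICIT algebraic expressions (for `κ ∈ ℚ`, elements of `ι(ℚ(ζ_m))`: tree `ratTwistedSymbolSum_ringHomComp`,
ibsb-9 `cuspFactor_comp_eq_map` / `gaussSum_ringHomComp_stdAddChar_eq_offset`), which is what the `p`-adic transport of ibsb-9's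
`padicCharSum_tmul_eq_of_charSum_eq` (p836061) consumes.  Frame-agnostic: `ι` is the datum's own family, no root of unity is chosen.
HONEST LABEL: helper lemmas; no stub of the istar skeleton is targeted or closed; the twist-period relation [P] (Shimura 1977) between
`f_W` and `f_V` symbol sums is NOT touched; nothing about 2c-T1, 19223, X12 or BSD is proved; 19223 OPEN; BSD is proved for no curve.
References: [Kato2004Asterisque] Thm. 6.6 (1) (p. 163), Thm. 9.7 (p. 189), §6.2 (p. 161); [MazurTateTeitelbaum1986Invent] §I.8 (8.6).
-/

noncomputable section

open scoped BigOperators NumberField TensorProduct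
open Field IsDedekindDomain CongruenceSubgroup
open Literature.NumberTheory.GaloisRepresentations
open Literature.NumberTheory.EllipticCurves Literature.NumberTheory.EllipticCurves.ModularForms
open Literature.NumberTheory.EllipticCurves.Kato2004 Literature.NumberTheory.EllipticCurves.Kato2004.EulerSystemValues
open Rat.HeightOneSpectrum
open Summit.BirchSwinnertonDyer.Rank1Residual.Additive.PerrinRiouUnit (isDepletedTwistedL_eulerFactors_mul)

namespace Summit.BirchSwinnertonDyer.BirchSwinnertonDyer.Theorems.CccOnePeriodFreeValueLaw

variable {W : WeierstrassCurve ℚ} [W.IsElliptic] {p : ℕ} [Fact p.Prime] [ContinuousSMul ℤ_[p] (W.tateModule p)]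
  [Module.Free ℤ_[p] (W.tateModule p)] [Module.Finite ℤ_[p] (W.tateModule p)]
  {N : ℕ} [NeZero N] {f : CuspForm (Gamma0 N) 2} {ι : (m : ℕ) → (CyclotomicField m ℚ →+* ℂ)} {κ : ℝ}
  {Λ : ∀ (k : ℕ) (r : Finset (HeightOneSpectrum (𝓞 ℚ))),
    H1 (tateRep W p) (cycSubgroup p k r) →ₗ[ℤ_[p]] ℚ_[p] ⊗[ℚ] CyclotomicField (cycLevel p k r) ℚ}
  {c d a : ℤ} {A : ℕ}
  {z : ∀ (k : ℕ) (r : (cyclotomicLevelsRat p (badPlaces c d A N)).Ideals),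
    H1 (tateRep W p) ((cyclotomicLevelsRat p (badPlaces c d A N)).level k r.1)}
  {x : ∀ (k : ℕ) (r : (cyclotomicLevelsRat p (badPlaces c d A N)).Ideals), CyclotomicField (cycLevel p k r.1) ℚ}

/-- `χ̄(−1) = χ(−1)` for a complex Dirichlet character (`χ(−1) = ±1`). [folklore] -/
theorem inv_apply_neg_one {m : ℕ} (χ : DirichletCharacter ℂ m) : χ⁻¹ (-1) = χ (-1) := by
  have h : ((-1 : (ZMod m)ˣ) : ZMod m) = -1 := by rw [Units.val_neg, Units.val_one]
  rw [← h, MulChar.inv_apply, Ring.inverse_unit, inv_neg_one]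

/-! ## §1 Even characters: `τ(χ̄) · Σ_b χ(b) ι(σ_b x) = κ · P_χ(1) · (Σ_a χ̄(a)[a/m]⁺_f) · R⁻_χ̄` -/

/-- ★ **Kato's even value law (C5), PERIOD-FREE.** Let `ZetaBody W p f ι κ Λ c d a A z x` (Kato (8.1.3)/Ex. 13.3 matrix) with `f` a
RATIONAL newform (`IsNewform0 f`, `coeffField f = ⊥`), `A ≠ 0`, a level `(k, r)` (`m = cycLevel p k r`), `d′` with `dd′ ≡ 1 (A)`,
`(cd, mA) = 1`, and `χ` a PRIMITIVE EVEN Dirichlet character mod `m`.  Then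
`τ(χ̄) · Σ_b χ(b) ι_m(σ_b x_{k,r}) = κ · P_χ(1) · (Σ_{a mod m} χ̄(a)[a/m]⁺_f) · R⁻_χ̄(c,d,a,A,d′)`,
`P_χ(1) = ∏_{ℓ ∣ m·pA, ℓ ∤ m} (1 − χ(ℓ)a_ℓ ℓ⁻¹ + 𝟙_N(ℓ)χ(ℓ)² ℓ·(ℓ⁻¹)²)`, `τ(χ̄) = gaussSum χ⁻¹ stdAddChar` — (C5) at the depleted
continuation `P_χ · L₀` (tree `isDepletedTwistedL_eulerFactors_mul`) and Birch's formula (file 1 `gaussSum_mul_apply_one_eq_of_even`),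
the period `Ω⁺_f > 0` (`IsNewform0.plusPeriod_pos_holds`) cancelled; `χ̄` is primitive by Mathlib `conductor_inv` (the tree's
`isPrimitive_inv` lives in an automorphic module not imported here).
[cite: Kato2004Asterisque, Thm. 9.7 (p. 189), Thm. 6.6 (1) (p. 163), §6.2 (p. 161)] [cite: MazurTateTeitelbaum1986Invent, §I.8 (8.6)] -/
theorem gaussSum_inv_mul_charSum_eq_of_even (hbody : ZetaBody W p f ι κ Λ c d a A z x) (hf : IsNewform0 f)
    (hQ : coeffField f = ⊥) (hA : A ≠ 0) (k : ℕ) (r : (cyclotomicLevelsRat p (badPlaces c d A N)).Ideals)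
    (d' : ℤ) (hcd : Int.gcd (c * d) (cycLevel p k r.1 * A) = 1) (hdd : d * d' ≡ 1 [ZMOD (A : ℤ)])
    {χ : DirichletCharacter ℂ (cycLevel p k r.1)} (hχ : χ.IsPrimitive) (heven : χ (-1) = 1) :
    gaussSum χ⁻¹ (ZMod.stdAddChar (N := cycLevel p k r.1)) *
        charSum (cycLevel p k r.1) (ι (cycLevel p k r.1)) χ (x k r) =
      (κ : ℂ) * (∏ ℓ ∈ (cycLevel p k r.1 * (p * A)).primeFactors.filter (fun ℓ => ¬ ℓ ∣ cycLevel p k r.1),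
          (1 - χ (ℓ : ZMod (cycLevel p k r.1)) * cuspCoeff f ℓ * (ℓ : ℂ) ^ (-(1 : ℂ)) +
            (if ℓ ∣ N then 0 else (ℓ : ℂ)) * χ (ℓ : ZMod (cycLevel p k r.1)) ^ 2 * ((ℓ : ℂ) ^ (-(1 : ℂ))) ^ 2)) *
        ratTwistedSymbolSum f χ⁻¹ * cuspFactor f true (fun n ↦ χ⁻¹ (n : ZMod (cycLevel p k r.1))) c d a A d' := by
  haveI : NeZero (p * A) := ⟨mul_ne_zero (Fact.out : p.Prime).ne_zero hA⟩
  obtain ⟨L₀, hd, hs⟩ := exists_differentiable_eq_twistedLSeries_holds f χ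
  obtain ⟨L, hL⟩ : ∃ L : ℂ → ℂ, IsDepletedTwistedL f (cycLevel p k r.1) (p * A) χ L :=
    ⟨_, isDepletedTwistedL_eulerFactors_mul (M := p * A) hf χ hd hs⟩
  -- (C5), even clause, at the depleted continuation `L`
  have h5 := ((hbody.2.2.2.2.2) k r d' χ L hcd hdd hL).1 heven
  -- Birch, depleted (file 1) at the primitive even character `χ̄`, continuation of `χ = χ̄⁻¹`
  have hχ' : χ⁻¹.IsPrimitive := by
    rw [DirichletCharacter.isPrimitive_def] at hχ ⊢
    rw [DirichletCharacter.conductor_inv, hχ]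
  have heven' : DirichletCharacter.Even χ⁻¹ := by
    show χ⁻¹ (-1) = 1
    rw [inv_apply_neg_one, heven]
  have hL' : IsDepletedTwistedL f (cycLevel p k r.1) (p * A) χ⁻¹⁻¹ L := by rwa [inv_inv]
  have hB := CccOneDepletedValueGlue.gaussSum_mul_apply_one_eq_of_even hf hQ hχ' heven' hL'
  rw [inv_inv] at hB
  have hΩ : (plusPeriod f : ℂ) ≠ 0 := by exact_mod_cast (IsNewform0.plusPeriod_pos_holds hf hQ).ne'
  -- cancel the period
  have h5' : charSum (cycLevel p k r.1) (ι (cycLevel p k r.1)) χ (x k r) * (plusPeriod f : ℂ) =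
      (κ : ℂ) * L 1 * cuspFactor f true (fun n ↦ χ⁻¹ (n : ZMod (cycLevel p k r.1))) c d a A d' := by
    rw [h5]
    field_simp
  apply mul_right_cancel₀ hΩ
  calc gaussSum χ⁻¹ (ZMod.stdAddChar (N := cycLevel p k r.1)) *
          charSum (cycLevel p k r.1) (ι (cycLevel p k r.1)) χ (x k r) * (plusPeriod f : ℂ)
        = gaussSum χ⁻¹ (ZMod.stdAddChar (N := cycLevel p k r.1)) *
          (charSum (cycLevel p k r.1) (ι (cycLevel p k r.1)) χ (x k r) * (plusPeriod f : ℂ)) := by ring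
    _ = (κ : ℂ) * cuspFactor f true (fun n ↦ χ⁻¹ (n : ZMod (cycLevel p k r.1))) c d a A d' *
          (gaussSum χ⁻¹ (ZMod.stdAddChar (N := cycLevel p k r.1)) * L 1) := by rw [h5']; ring
    _ = _ := by rw [hB]; ring

/-- **Solved form**: `Σ_b χ(b) ι(σ_b x_{k,r}) = κ · P_χ(1) · (Σ_a χ̄(a)[a/m]⁺_f) · R⁻_χ̄ / τ(χ̄)` (`τ(χ̄) ≠ 0` for the primitive `χ̄`,
tree `Literature.NumberTheory.LFunctions.gaussSum_ne_zero`): the EVEN (C5)-value is an explicit ALGEBRAIC number — no `L`-value,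
no period. [cite: Kato2004Asterisque, Thm. 9.7 (p. 189), Thm. 6.6 (1) (p. 163)] [cite: MazurTateTeitelbaum1986Invent, §I.8 (8.6)] -/
theorem charSum_eq_of_even (hbody : ZetaBody W p f ι κ Λ c d a A z x) (hf : IsNewform0 f)
    (hQ : coeffField f = ⊥) (hA : A ≠ 0) (k : ℕ) (r : (cyclotomicLevelsRat p (badPlaces c d A N)).Ideals)
    (d' : ℤ) (hcd : Int.gcd (c * d) (cycLevel p k r.1 * A) = 1) (hdd : d * d' ≡ 1 [ZMOD (A : ℤ)])
    {χ : DirichletCharacter ℂ (cycLevel p k r.1)} (hχ : χ.IsPrimitive) (heven : χ (-1) = 1) :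
    charSum (cycLevel p k r.1) (ι (cycLevel p k r.1)) χ (x k r) =
      (κ : ℂ) * (∏ ℓ ∈ (cycLevel p k r.1 * (p * A)).primeFactors.filter (fun ℓ => ¬ ℓ ∣ cycLevel p k r.1),
          (1 - χ (ℓ : ZMod (cycLevel p k r.1)) * cuspCoeff f ℓ * (ℓ : ℂ) ^ (-(1 : ℂ)) +
            (if ℓ ∣ N then 0 else (ℓ : ℂ)) * χ (ℓ : ZMod (cycLevel p k r.1)) ^ 2 * ((ℓ : ℂ) ^ (-(1 : ℂ))) ^ 2)) *
        ratTwistedSymbolSum f χ⁻¹ * cuspFactor f true (fun n ↦ χ⁻¹ (n : ZMod (cycLevel p k r.1))) c d a A d' /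
        gaussSum χ⁻¹ (ZMod.stdAddChar (N := cycLevel p k r.1)) := by
  have hχ' : χ⁻¹.IsPrimitive := by
    have h := hχ
    rw [DirichletCharacter.isPrimitive_def] at h ⊢
    rw [DirichletCharacter.conductor_inv, h]
  have hτ := Literature.NumberTheory.LFunctions.gaussSum_ne_zero χ⁻¹ hχ'
  rw [eq_div_iff hτ, mul_comm]
  exact gaussSum_inv_mul_charSum_eq_of_even hbody hf hQ hA k r d' hcd hdd hχ heven

/-! ## §2 Odd characters: `τ(χ̄) · Σ_b χ(b) ι(σ_b x) = −κ · P_χ(1) · (Σ_a χ̄(a)[a/m]⁻_f) · R⁺_χ̄` -/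

/-- ★ **Kato's odd value law (C5), PERIOD-FREE.** Same data, `χ` a PRIMITIVE ODD character mod `m`:
`τ(χ̄) · Σ_b χ(b) ι_m(σ_b x_{k,r}) = −κ · P_χ(1) · (Σ_{a mod m} χ̄(a)[a/m]⁻_f) · R⁺_χ̄(c,d,a,A,d′)` — (C5)'s odd clause
`−κ · Lχ(1)/(iΩ⁻_f) · R⁺_χ̄` with Birch's odd formula (file 1 `gaussSum_mul_apply_one_eq_of_odd`), `Ω⁻_f > 0`
(`IsNewform0.minusPeriod_pos_holds`) and `i` cancelled. [cite: Kato2004Asterisque, Thm. 9.7 (p. 189), Thm. 6.6 (1) (p. 163), §6.2 (p. 161)]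
[cite: MazurTateTeitelbaum1986Invent, §I.8 (8.6)] -/
theorem gaussSum_inv_mul_charSum_eq_of_odd (hbody : ZetaBody W p f ι κ Λ c d a A z x) (hf : IsNewform0 f)
    (hQ : coeffField f = ⊥) (hA : A ≠ 0) (k : ℕ) (r : (cyclotomicLevelsRat p (badPlaces c d A N)).Ideals)
    (d' : ℤ) (hcd : Int.gcd (c * d) (cycLevel p k r.1 * A) = 1) (hdd : d * d' ≡ 1 [ZMOD (A : ℤ)])
    {χ : DirichletCharacter ℂ (cycLevel p k r.1)} (hχ : χ.IsPrimitive) (hodd : χ (-1) = -1) :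
    gaussSum χ⁻¹ (ZMod.stdAddChar (N := cycLevel p k r.1)) *
        charSum (cycLevel p k r.1) (ι (cycLevel p k r.1)) χ (x k r) =
      -(κ : ℂ) * (∏ ℓ ∈ (cycLevel p k r.1 * (p * A)).primeFactors.filter (fun ℓ => ¬ ℓ ∣ cycLevel p k r.1),
          (1 - χ (ℓ : ZMod (cycLevel p k r.1)) * cuspCoeff f ℓ * (ℓ : ℂ) ^ (-(1 : ℂ)) +
            (if ℓ ∣ N then 0 else (ℓ : ℂ)) * χ (ℓ : ZMod (cycLevel p k r.1)) ^ 2 * ((ℓ : ℂ) ^ (-(1 : ℂ))) ^ 2)) *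
        ratMinusTwistedSymbolSum f χ⁻¹ * cuspFactor f false (fun n ↦ χ⁻¹ (n : ZMod (cycLevel p k r.1))) c d a A d' := by
  haveI : NeZero (p * A) := ⟨mul_ne_zero (Fact.out : p.Prime).ne_zero hA⟩
  obtain ⟨L₀, hd, hs⟩ := exists_differentiable_eq_twistedLSeries_holds f χ
  obtain ⟨L, hL⟩ : ∃ L : ℂ → ℂ, IsDepletedTwistedL f (cycLevel p k r.1) (p * A) χ L :=
    ⟨_, isDepletedTwistedL_eulerFactors_mul (M := p * A) hf χ hd hs⟩
  have h5 := ((hbody.2.2.2.2.2) k r d' χ L hcd hdd hL).2 hodd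
  have hχ' : χ⁻¹.IsPrimitive := by
    rw [DirichletCharacter.isPrimitive_def] at hχ ⊢
    rw [DirichletCharacter.conductor_inv, hχ]
  have hodd' : DirichletCharacter.Odd χ⁻¹ := by
    show χ⁻¹ (-1) = -1
    rw [inv_apply_neg_one, hodd]
  have hL' : IsDepletedTwistedL f (cycLevel p k r.1) (p * A) χ⁻¹⁻¹ L := by rwa [inv_inv]
  have hB := CccOneDepletedValueGlue.gaussSum_mul_apply_one_eq_of_odd hf hQ hχ' hodd' hL'
  rw [inv_inv] at hB
  have hΩ : (minusPeriod f : ℂ) ≠ 0 := by exact_mod_cast (IsNewform0.minusPeriod_pos_holds hf hQ).ne'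
  have hI : Complex.I ≠ 0 := Complex.I_ne_zero
  have hIΩ : Complex.I * (minusPeriod f : ℂ) ≠ 0 := mul_ne_zero hI hΩ
  have h5' : charSum (cycLevel p k r.1) (ι (cycLevel p k r.1)) χ (x k r) * (Complex.I * (minusPeriod f : ℂ)) =
      -(κ : ℂ) * L 1 * cuspFactor f false (fun n ↦ χ⁻¹ (n : ZMod (cycLevel p k r.1))) c d a A d' := by
    rw [h5]
    field_simp
  apply mul_right_cancel₀ hIΩ
  calc gaussSum χ⁻¹ (ZMod.stdAddChar (N := cycLevel p k r.1)) *
          charSum (cycLevel p k r.1) (ι (cycLevel p k r.1)) χ (x k r) * (Complex.I * (minusPeriod f : ℂ))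
        = gaussSum χ⁻¹ (ZMod.stdAddChar (N := cycLevel p k r.1)) *
          (charSum (cycLevel p k r.1) (ι (cycLevel p k r.1)) χ (x k r) * (Complex.I * (minusPeriod f : ℂ))) := by
          ring
    _ = -(κ : ℂ) * cuspFactor f false (fun n ↦ χ⁻¹ (n : ZMod (cycLevel p k r.1))) c d a A d' *
          (gaussSum χ⁻¹ (ZMod.stdAddChar (N := cycLevel p k r.1)) * L 1) := by rw [h5']; ring
    _ = _ := by rw [hB]; ring

/-- **Solved form, odd parity**: `Σ_b χ(b) ι(σ_b x_{k,r}) = −κ · P_χ(1) · (Σ_a χ̄(a)[a/m]⁻_f) · R⁺_χ̄ / τ(χ̄)`.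
[cite: Kato2004Asterisque, Thm. 9.7 (p. 189), Thm. 6.6 (1) (p. 163)] [cite: MazurTateTeitelbaum1986Invent, §I.8 (8.6)] -/
theorem charSum_eq_of_odd (hbody : ZetaBody W p f ι κ Λ c d a A z x) (hf : IsNewform0 f)
    (hQ : coeffField f = ⊥) (hA : A ≠ 0) (k : ℕ) (r : (cyclotomicLevelsRat p (badPlaces c d A N)).Ideals)
    (d' : ℤ) (hcd : Int.gcd (c * d) (cycLevel p k r.1 * A) = 1) (hdd : d * d' ≡ 1 [ZMOD (A : ℤ)])
    {χ : DirichletCharacter ℂ (cycLevel p k r.1)} (hχ : χ.IsPrimitive) (hodd : χ (-1) = -1) :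
    charSum (cycLevel p k r.1) (ι (cycLevel p k r.1)) χ (x k r) =
      -(κ : ℂ) * (∏ ℓ ∈ (cycLevel p k r.1 * (p * A)).primeFactors.filter (fun ℓ => ¬ ℓ ∣ cycLevel p k r.1),
          (1 - χ (ℓ : ZMod (cycLevel p k r.1)) * cuspCoeff f ℓ * (ℓ : ℂ) ^ (-(1 : ℂ)) +
            (if ℓ ∣ N then 0 else (ℓ : ℂ)) * χ (ℓ : ZMod (cycLevel p k r.1)) ^ 2 * ((ℓ : ℂ) ^ (-(1 : ℂ))) ^ 2)) *
        ratMinusTwistedSymbolSum f χ⁻¹ * cuspFactor f false (fun n ↦ χ⁻¹ (n : ZMod (cycLevel p k r.1))) c d a A d' /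
        gaussSum χ⁻¹ (ZMod.stdAddChar (N := cycLevel p k r.1)) := by
  have hχ' : χ⁻¹.IsPrimitive := by
    have h := hχ
    rw [DirichletCharacter.isPrimitive_def] at h ⊢
    rw [DirichletCharacter.conductor_inv, h]
  have hτ := Literature.NumberTheory.LFunctions.gaussSum_ne_zero χ⁻¹ hχ'
  rw [eq_div_iff hτ, mul_comm]
  exact gaussSum_inv_mul_charSum_eq_of_odd hbody hf hQ hA k r d' hcd hdd hχ hodd

end Summit.BirchSwinnertonDyer.BirchSwinnertonDyer.Theorems.CccOnePeriodFreeValueLaw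

end
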